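import Summits.Langlands.Langlands.Theorems.AbelianSurfaceSerreSerreGSp4SurjectiveSingerFamilyDefs
import Literature.NumberTheory.Automorphic.PotentialAutomorphyCompatibleSystemGL4Rational
import Literature.NumberTheory.GaloisRepresentations.CompatibleSystemResidualIrreducibility
import Literature.NumberTheory.GaloisRepresentations.CompatibleSystemIrreducibility
import Literature.NumberTheory.GaloisRepresentations.CyclotomicPowerTwistProofs
import Literature.NumberTheory.LFunctions.DirichletDensityRatTransport
import Literature.NumberTheory.LFunctions.NumberFieldDirichletDensityCalculus
import Literature.FieldTheory.AlgClosed.PadicAlgClEquivComplex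
import HarnessLib

/-!
# Route `AbelianSurfaceSerre`, crux `SerreGSp4Surjective` (stmt-Langlands-17765), line
# `singer-type-evaporation`: stub 3/7 `stub_companions` (skeleton v8.1) — the `ℓ`-adic companions

The companions layer of the family `SingerFamily p ρ̄` (accepted vocabulary file
`AbelianSurfaceSerreSerreGSp4SurjectiveSingerFamilyDefs`, p164075) over a given crystalline-ordinary
symplectic lift `L : OrdinaryLift p ρ̄`, `p ≥ 11`, `ρ̄` irreducible on `Γ_{ℚ(ζ_p)}`, from THREE named
facts taken as antecedents (D-0014):

* `BLGGT2014_thm551_compatibleSystem_rat_GL4` (accepted, p159229): `L.lift` — symplectic with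
  multiplier `ε_p⁻¹` (`cycInv p` IS the fact's multiplier function, definitionally), unramified a.e.,
  with four distinct labelled weights `L.wts`, de Rham with `N = 0` and an invariant full flag at `p`
  (the fact's second alternative: `lift_potCrystalline` and the frame of `lift_ordinary`), reducing to
  `ρ̄` along some `red` (`lift_reducesTo`, `k = ZMod p`) with `ρ̄` irreducible on `ker ε̄_p`
  (`IrredOnCycKernel`, same body) — is the `(p, ι₀)`-member of a weakly compatible system `𝓡` of
  weight `L.wts` (`IsWeaklyCompatibleSystemRat 4 S Q L.wts 𝓡`);
* `BLGGT2014_prop532_residuallyIrreducible_densityOne` (accepted, p158720): a density-one set `L₁`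
  of primes at which the irreducible members are residually irreducible on `Γ_{ℚ(ζ_ℓ)}`;
* `PatrikisTaylor2015_thm17_irreducibleMembers_rat_GL4` (vendored FOR this stub as the Literature
  file `Literature/NumberTheory/GaloisRepresentations/CompatibleSystemIrreducibility.lean`, accepted
  p169196): a set `L₂` having a positive Dirichlet density at which ALL members of any weakly
  compatible system through such an `r` are irreducible — Patrikis–Taylor 2015 Thm. 1.7 for the
  potentially automorphic `r` (BLGGT 2014 Cor. 4.5.2); printed statements and the derivation in that
  file's module docstring.

Then `good := L₁ ∩ L₂ ∩ {ℓ : the place of ℓ is not in S}`, `companion ℓ := 𝓡 ℓ ι_ℓ` for one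
chosen `ι_ℓ : ℚ̄_ℓ ≃ ℂ` (`PadicAlgCl.nonempty_ringEquiv_complex`); `companion_crystalline` and the
labelled weights from the system (`ℓ`'s place `∉ S`); `companion_compatible` (`CompanionAE`): given
`ι'`, the isomorphism `ι := ι' ∘ ι_ℓ⁻¹ ∘ ι₀ : ℚ̄_p ≃ ℂ` turns the Satake-type Frobenius polynomials of
the companion via `ι'` into those of the lift via `ι` at every `v ∉ S ∪ {v ∣ p} ∪ {v ∣ ℓ}` (the
lift carries `ι₀⁻¹(Q v)`, the companion `ι_ℓ⁻¹(Q v)`; Frobenius polynomials are unique,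
`hasFrobCharpolyAt_unique`);
`companion_irreducible` from `L₂`; `companion_rigid` from `L₁`; `good_unbounded`: `L₁ ∩ L₂` has the
positive density of `L₂` (`hasDirichletDensity_inter_of_one`, transported from the accepted
number-field calculus `NumberField.HasDirichletDensity.inter_of_one` along
`hasDirichletDensity_rat_iff_natPrimesOf`), hence contains primes beyond any bound
(`PrimeSum.exists_gt_of_tendsto_pos`), and only finitely many primes lie in a place of `S`
(`exists_bound_natCast_mem_asIdeal`: a nonzero prime of `𝓞 ℚ` contains at most one rational prime).

Main theorems: `stub_companions_of` (hypotheses explicit) and `stub_companions` — the registered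
signature of skeleton v8.1 with the vendored fact as a THIRD antecedent (to be re-registered in this
form).  `p₂ = 11`.

References: BarnetlambEtAl2014 Thm. 5.5.1, Prop. 5.3.2, Cor. 4.5.2, §5.1; PatrikisTaylor2014
Thm. 1.7; NeukirchANT1999 VII (13.1) (Dirichlet density).
-/

set_option linter.dupNamespace false -- `Summit.Langlands.Langlands` is the mandated namespace

namespace Summit.Langlands.Langlands.Cruxes.SerreGSp4Surjective.SingerTypeEvaporation

open Literature.NumberTheory.GaloisRepresentations Literature.NumberTheory.Automorphic
  Literature.NumberTheory.PAdicHodge Literature.NumberTheory.LFunctions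
open scoped NumberField
open IsDedekindDomain Polynomial Filter

noncomputable section

/-! ## Glue: Frobenius polynomials, densities, places -/

/-- Frobenius characteristic polynomials of a framed representation of `Γ_K`, `K` a number field,
are unique at every finite place (there is a prime above `v` and a Frobenius at it; framed copy of
the accepted `GaloisRep.HasFrobCharpolyAt.unique_holds`). [folklore] -/
theorem hasFrobCharpolyAt_unique {K : Type*} [Field K] [NumberField K] {A : Type*} [CommRing A]
    [TopologicalSpace A] {n : ℕ} {v : HeightOneSpectrum (𝓞 K)} {r : FramedGaloisRep K A n}
    {P P' : Polynomial A} (hP : r.HasFrobCharpolyAt v P) (hP' : r.HasFrobCharpolyAt v P') :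
    P = P' := by
  obtain ⟨𝔓, h𝔓⟩ := HeightOneSpectrum.primesAbove_nonempty v
  obtain ⟨σ, hσ⟩ := HeightOneSpectrum.exists_isArithFrobAt_of_mem_primesAbove_holds h𝔓
  rw [← hP 𝔓 h𝔓 σ hσ, ← hP' 𝔓 h𝔓 σ hσ]

/-- Transport of Satake-type Frobenius polynomials between coefficient fields: if
`φ : ℚ̄_ℓ → ℚ̄_p` satisfies `φ ∘ ι'⁻¹ = ι⁻¹` on `ℂ`, then `φ (C_{q,m}(a) ∘ ι'⁻¹) = C_{q,m}(a) ∘ ι⁻¹`.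
[folklore] -/
theorem arithFrobPolyOfSatake_map {p ℓ : ℕ} [Fact p.Prime] [Fact ℓ.Prime] (ι' : PadicAlgCl ℓ ≃+* ℂ)
    (ι : PadicAlgCl p ≃+* ℂ) (φ : PadicAlgCl ℓ →+* PadicAlgCl p)
    (hφ : ∀ z : ℂ, φ (ι'.symm z) = ι.symm z) (q m : ℕ) (a : Multiset ℂ) :
    (arithFrobPolyOfSatake ι' q m a).map φ = arithFrobPolyOfSatake ι q m a := by
  simp only [arithFrobPolyOfSatake, Polynomial.map_multiset_prod, Multiset.map_map,
    Function.comp_def, Polynomial.map_sub, Polynomial.map_X, Polynomial.map_C, hφ]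

/-- The ℕ-indexed Dirichlet density of a set of rational primes is Neukirch's density over `ℚ` of
the corresponding set of places (accepted `hasDirichletDensity_rat_iff_natPrimesOf`). [folklore] -/
theorem hasDirichletDensity_iff_numberField (X : Set ℕ) (d : ℝ) :
    HasDirichletDensity X d ↔ NumberField.HasDirichletDensity ℚ
      {v : HeightOneSpectrum (𝓞 ℚ) | ((Rat.HeightOneSpectrum.primesEquiv v : Nat.Primes) : ℕ) ∈ X}
        d := by
  rw [NumberField.hasDirichletDensity_rat_iff_natPrimesOf]
  refine hasDirichletDensity_congr fun q hq => ⟨fun hqX => ?_, fun hqn => ?_⟩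
  · refine ⟨Rat.HeightOneSpectrum.primesEquiv.symm ⟨q, hq⟩, ?_, ?_⟩ <;> simp [hqX]
  · obtain ⟨v, hv, rfl⟩ := hqn
    exact hv

/-- **A density-one set of primes meets a set of density `c` in density `c`** (ℕ-indexed form of
the accepted `NumberField.HasDirichletDensity.inter_of_one`). [folklore] -/
theorem hasDirichletDensity_inter_of_one {L T : Set ℕ} {c : ℝ} (hL : HasDirichletDensity L 1)
    (hT : HasDirichletDensity T c) : HasDirichletDensity (L ∩ T) c := by
  rw [hasDirichletDensity_iff_numberField] at hL hT ⊢
  exact hL.inter_of_one hT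

/-- A nonzero prime of `𝓞 ℚ` contains at most one rational prime (two distinct primes are coprime,
Bézout). [folklore] -/
theorem natCast_mem_asIdeal_unique (v : HeightOneSpectrum (𝓞 ℚ)) {ℓ ℓ' : ℕ} (hℓ : ℓ.Prime)
    (hℓ' : ℓ'.Prime) (h : ((ℓ : ℕ) : 𝓞 ℚ) ∈ v.asIdeal) (h' : ((ℓ' : ℕ) : 𝓞 ℚ) ∈ v.asIdeal) :
    ℓ = ℓ' := by
  by_contra hne
  obtain ⟨a, b, hab⟩ : IsCoprime (ℓ : ℤ) (ℓ' : ℤ) :=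
    Nat.isCoprime_iff_coprime.mpr ((Nat.coprime_primes hℓ hℓ').mpr hne)
  refine v.isPrime.ne_top ((Ideal.eq_top_iff_one _).mpr ?_)
  have h1 : ((a : ℤ) : 𝓞 ℚ) * ((ℓ : ℕ) : 𝓞 ℚ) + ((b : ℤ) : 𝓞 ℚ) * ((ℓ' : ℕ) : 𝓞 ℚ) = 1 := by
    have := congrArg (fun x : ℤ => (x : 𝓞 ℚ)) hab
    push_cast at this
    exact this
  rw [← h1]
  exact v.asIdeal.add_mem (v.asIdeal.mul_mem_left _ h) (v.asIdeal.mul_mem_left _ h')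

/-- For a finite set `S` of places of `ℚ`, all sufficiently large primes `ℓ` lie in no place of `S`.
[folklore] -/
theorem exists_bound_natCast_mem_asIdeal (S : Finset (HeightOneSpectrum (𝓞 ℚ))) :
    ∃ B : ℕ, ∀ ℓ : ℕ, ℓ.Prime → B < ℓ → ∀ v ∈ S, ((ℓ : ℕ) : 𝓞 ℚ) ∉ v.asIdeal := by
  classical
  let f : HeightOneSpectrum (𝓞 ℚ) → ℕ := fun v =>
    if h : ∃ ℓ : ℕ, ℓ.Prime ∧ ((ℓ : ℕ) : 𝓞 ℚ) ∈ v.asIdeal then h.choose else 0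
  refine ⟨S.sup f, fun ℓ hℓ hB v hvS hmem => ?_⟩
  have hex : ∃ ℓ : ℕ, ℓ.Prime ∧ ((ℓ : ℕ) : 𝓞 ℚ) ∈ v.asIdeal := ⟨ℓ, hℓ, hmem⟩
  have hfv : f v = ℓ := by
    simp only [f, dif_pos hex]
    exact natCast_mem_asIdeal_unique v hex.choose_spec.1 hℓ hex.choose_spec.2 hmem
  have hle : f v ≤ S.sup f := Finset.le_sup hvS
  omega

/-! ## The stub, with the vendored fact as a third antecedent -/

/-- **Stub 3/7 `stub_companions`, corrected form** (registered signature with ONE extra antecedent,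
the vendored `PatrikisTaylor2015_thm17_irreducibleMembers_rat_GL4`).  For `p ≥ 11`, `ρ̄`
irreducible on `Γ_{ℚ(ζ_p)}` and any `OrdinaryLift`, a `SingerFamily` exists: module docstring.
[cite: BarnetlambEtAl2014, Thm. 5.5.1 and Prop. 5.3.2] [cite: PatrikisTaylor2014, Thm. 1.7] -/
theorem stub_companions_of (h551 : BLGGT2014_thm551_compatibleSystem_rat_GL4)
    (h532 : BLGGT2014_prop532_residuallyIrreducible_densityOne)
    (hPT : PatrikisTaylor2015_thm17_irreducibleMembers_rat_GL4) :
    ∃ p₂ : ℕ, ∀ (p : ℕ) [Fact p.Prime], p₂ ≤ p → ∀ ρ : FramedGaloisRep ℚ (ZMod p) 4,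
      IrredOnCycKernel p ρ → Nonempty (OrdinaryLift p ρ) → Nonempty (SingerFamily p ρ) := by
  refine ⟨11, fun p _ hp ρ hirr ⟨L⟩ => ?_⟩
  -- the `p`-adic hypothesis of BLGGT 5.5.1, second alternative (de Rham, `N = 0`, invariant flag)
  have hp_adic : ∀ (v : HeightOneSpectrum (𝓞 ℚ)) (hv : ((p : ℕ) : 𝓞 ℚ) ∈ v.asIdeal),
      let D := fontainePstAdicCompletion v p hv
      (letI := D.algebra
       ∀ τ : v.adicCompletion ℚ →ₐ[ℚ_[p]] PadicAlgCl p,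
        L.lift.labelledHodgeTateWeightsAt v D.algebra D.𝔅 τ.toRingHom = L.wts) ∧
      ((D.IsCrystallineFramed (L.lift.toLocal v) ∧
          ∃ a : ℤ, ∀ h ∈ L.wts, a ≤ h ∧ h ≤ a + ((p : ℤ) - 2)) ∨
        (D.IsDeRhamFramed (L.lift.toLocal v) ∧
          (∀ W, D.IsWeilDeligneOf (L.lift.toLocal v) W → W.N = 0) ∧
          ∃ g : GL (Fin 4) (PadicAlgCl p),
            ∀ (σ : Field.absoluteGaloisGroup (v.adicCompletion ℚ)) (i j : Fin 4), j < i →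
              ((g * L.lift.toLocal v σ * g⁻¹ : GL (Fin 4) (PadicAlgCl p)) :
                Matrix (Fin 4) (Fin 4) (PadicAlgCl p)) i j = 0)) := by
    intro v hv
    refine ⟨fun τ => (L.lift_crystalline v hv).2 τ,
      Or.inr ⟨(L.lift_potCrystalline v hv).1, (L.lift_potCrystalline v hv).2, ?_⟩⟩
    obtain ⟨g, ψ, -, htri, -⟩ := L.lift_ordinary v hv
    exact ⟨g, fun σ i j hji => htri σ i j hji⟩
  obtain ⟨red, hred⟩ := L.lift_reducesTo
  -- the weakly compatible system through the lift (BLGGT 5.5.1)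
  obtain ⟨S, Q, ι₀, 𝓡, hr, h𝓡, hfrobr, hfrob⟩ := h551.exists_member hp L.lift L.wts
    L.lift_unramified L.lift_symplectic L.wts_nodup L.wts_card hp_adic ρ red hred hirr
  -- irreducible members on a set of positive density (Patrikis–Taylor)
  obtain ⟨L₂, c, hc, hL₂, hirr₂⟩ := hPT p hp L.lift L.wts L.lift_unramified L.lift_symplectic
    L.wts_nodup L.wts_card hp_adic (ZMod p) ρ red hred hirr S Q ι₀ 𝓡 hr h𝓡
  -- residual rigidity on a density-one set (BLGGT 5.3.2)
  obtain ⟨L₁, hL₁, hrig⟩ := h532 4 S Q L.wts 𝓡 h𝓡 L.wts_nodup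
  obtain ⟨B, hB⟩ := exists_bound_natCast_mem_asIdeal S
  have hdens : HasDirichletDensity (L₁ ∩ L₂) c := hasDirichletDensity_inter_of_one hL₁ hL₂
  -- one `ι_ℓ : ℚ̄_ℓ ≃ ℂ` per prime
  obtain ⟨ιc⟩ : Nonempty (∀ (ℓ : ℕ) [Fact ℓ.Prime], PadicAlgCl ℓ ≃+* ℂ) :=
    ⟨fun ℓ _ => Classical.choice (PadicAlgCl.nonempty_ringEquiv_complex ℓ)⟩
  refine ⟨{ toOrdinaryLift := L,
            good := {ℓ | ℓ ∈ L₁ ∧ ℓ ∈ L₂ ∧ ∀ v ∈ S, ((ℓ : ℕ) : 𝓞 ℚ) ∉ v.asIdeal},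
            good_unbounded := fun N => ?_,
            companion := fun ℓ _ _ => 𝓡 ℓ (ιc ℓ),
            companion_crystalline := fun ℓ _ h v hv => ?_,
            companion_compatible := fun ℓ _ h ι' => ?_,
            companion_irreducible := fun ℓ _ h => hirr₂ ℓ h.2.1 (ιc ℓ),
            companion_rigid := fun ℓ _ h k _ _ _ _ _ ρ' red' hred' =>
              hrig ℓ h.1 (ιc ℓ) (hirr₂ ℓ h.2.1 (ιc ℓ)) k ρ' red' hred' }⟩
  · -- `good` is unbounded: positive density minus finitely many
    classical
    obtain ⟨ℓ, hℓ, ⟨hℓ₁, hℓ₂⟩, hgt⟩ :=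
      PrimeSum.exists_gt_of_tendsto_pos (X := L₁ ∩ L₂) hc
        (by convert hasDirichletDensity_iff.mp hdens using 6) (max N B)
    exact ⟨ℓ, hℓ, ⟨hℓ₁, hℓ₂, hB ℓ hℓ ((le_max_right _ _).trans_lt hgt)⟩,
      (le_max_left _ _).trans hgt.le⟩
  · -- crystalline at `ℓ` with labelled weights `wts`: the system, `ℓ`'s place not in `S`
    have hvS : v ∉ S := fun hvS => h.2.2 v hvS hv
    have hm := (h𝓡.member ℓ (ιc ℓ)).2.2 v hv
    exact ⟨hm.2.1 hvS, hm.2.2⟩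
  · -- a companion of the lift: `ι := ι' ∘ ι_ℓ⁻¹ ∘ ι₀`
    refine ⟨(ι₀.trans (ιc ℓ).symm).trans ι', ?_⟩
    have hS : ∀ᶠ v : HeightOneSpectrum (𝓞 ℚ) in cofinite, v ∉ S :=
      Filter.eventually_cofinite.mpr (S.finite_toSet.subset fun v hv => by simpa using hv)
    have hp0 : p ≠ 0 := (Fact.out : p.Prime).ne_zero
    have hℓ0 : ℓ ≠ 0 := (Fact.out : ℓ.Prime).ne_zero
    filter_upwards [hS, eventually_natCast_not_mem_asIdeal (K := ℚ) hp0,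
      eventually_natCast_not_mem_asIdeal (K := ℚ) hℓ0] with v hvS hvp hvℓ
    obtain ⟨hur, hPr⟩ := hfrobr v hvS hvp
    obtain ⟨huℓ, hPℓ⟩ := hfrob ℓ (ιc ℓ) v hvS hvℓ
    refine ⟨hur, huℓ, fun a ha => ?_⟩
    have heq := hasFrobCharpolyAt_unique ha hPℓ
    have key : arithFrobPolyOfSatake ((ι₀.trans (ιc ℓ).symm).trans ι') v.residueCard 4 a =
        (Q v).map (ι₀.symm : ℂ ≃+* PadicAlgCl p).toRingHom := by
      rw [← arithFrobPolyOfSatake_map ι' ((ι₀.trans (ιc ℓ).symm).trans ι')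
        ((ιc ℓ).trans ι₀.symm).toRingHom (fun z => rfl), heq, Polynomial.map_map]
      congr 1
      ext z
      simp
    rw [key]
    exact hPr

/-- **Stub 3/7 `stub_companions` — the registered signature WITH the vendored fact as a third
antecedent** (the form the lead re-registers; `stub-misstated` w.r.t. skeleton v8.1, whose signature
had only the two BLGGT facts: irreducibility of the companions is served by neither).
[cite: BarnetlambEtAl2014, Thm. 5.5.1 and Prop. 5.3.2] [cite: PatrikisTaylor2014, Thm. 1.7] -/
theorem stub_companions :
    BLGGT2014_thm551_compatibleSystem_rat_GL4 → BLGGT2014_prop532_residuallyIrreducible_densityOne →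
    PatrikisTaylor2015_thm17_irreducibleMembers_rat_GL4 →
    ∃ p₂ : ℕ, ∀ (p : ℕ) [Fact p.Prime], p₂ ≤ p → ∀ ρ : FramedGaloisRep ℚ (ZMod p) 4,
      IrredOnCycKernel p ρ → Nonempty (OrdinaryLift p ρ) → Nonempty (SingerFamily p ρ) :=
  fun h551 h532 hPT => stub_companions_of h551 h532 hPT

end

end Summit.Langlands.Langlands.Cruxes.SerreGSp4Surjective.SingerTypeEvaporation
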